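import Literature.LinearAlgebra.Matrix.IntegralUnitaryConjugacyOfRegularElements
import HarnessLib

/-!
# The Cartan algebra `L[γ] = Z(γ)` of a regular semisimple unitary matrix: commutant, reduced, stable under the `H`-adjoint
# `X ↦ X⋆ = H⁻¹ ᵗ(σX) H`; base change of the adjoint (Rogawski 1990 §3.5; Horn–Johnson Thm. 3.2.4.2)

Topic `LinearAlgebra/Matrix`; namespace `Literature.LinearAlgebra.Matrix`.  THEOREMS ONLY (no definition, no instance, no notation, no
named fact); Mathlib + ★ `NonderogatoryCommutant` + ★ `IntegralUnitaryConjugacyOfRegularElements` (whose §1 is the adjoint anti-involution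
`τ(X) = J⁻¹ ᵗ(σX) J`, spelled out, never defined: `hermAdjoint_mul`, `hermAdjoint_one`, `hermAdjoint_hermAdjoint`, `hermAdjoint_add`,
`hermAdjoint_smul`, `commute_hermAdjoint_of_commute` — REUSED here by name, same spelling).  Matrix plumbing of the floor-0 unitary
stabilisation (engine T1, row G6 «pre-stabilisation for the U(3) tori»): consumers `GaloisRepresentations/HasseNormEtaleInvolutionMatrix`
(the adelic-to-rational norm principle for the Cartan algebra) and `Rogawski1990/CartanInvariant` ∕ `RationalClassesInjectAdelically`.

THE PRINT.  [Rogawski1990, §3.5 p. 29]: for `γ` regular in `U(H)(F) ⊂ GL_N(L)` the centraliser `T = G_γ` is a maximal torus, `L[γ]` an étale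
algebra stable under the involution induced by `H`, and `T ≅ {x ∈ L[γ] : x x⋆ = 1}`.  [HornJohnson2013, Thm. 3.2.4.2 p. 236]: the commutant of
a nonderogatory matrix `A` is `K[A]`.

* §1 `map_hermAdjoint` — the adjoint commutes with a change of rings `f : A → A′` intertwining the involutions (`f σ = σ′ f`):
  `(J⁻¹ ᵗ(σX) J).map f = (J.map f)⁻¹ ᵗ(σ′(X.map f)) (J.map f)` (base change `L → 𝔸_L`, `L → ∏_{w∣v} L_w`); `map_nonsing_inv_of_isUnit`.
* §2 (`L` a field, `γ ∈ M_N(L)` with SEPARABLE characteristic polynomial): `Z(γ) ⊆ L[γ]` (`mem_adjoin_singleton_of_commute`, Horn–Johnson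
  3.2.4.2 through ★ `exists_eq_aeval_of_commute_of_minpoly_eq_charpoly`), `L[γ] ⊆ Z(γ)` (`commute_of_mem_adjoin_singleton`, any commutative
  ring), **`isReduced_adjoin_singleton`** (`L[γ]` is REDUCED: a nilpotent `p(γ)` has `q_γ ∣ p^k` with `q_γ = p_γ` square-free, so `q_γ ∣ p`),
  and **`hermAdjoint_mem_adjoin_singleton`**: `L[γ]` is `⋆`-stable when `γ` is `H`-unitary (`ᵗ(σγ) H γ = H`).

## References
* J. D. Rogawski, *Automorphic Representations of Unitary Groups in Three Variables*, Ann. of Math. Stud. 123 (1990), §3.5 p. 29 [Rogawski1990].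
* R. A. Horn, C. R. Johnson, *Matrix Analysis*, 2nd ed. (2013), Thm. 3.2.4.2 p. 236 [HornJohnson2013].
* R. Jacobowitz, *Hermitian forms over local fields*, Amer. J. Math. 84 (1962), §2 [Jacobowitz1962].
-/

open Polynomial
open scoped Matrix

namespace Literature.LinearAlgebra.Matrix

/-! ## §1 Base change of the adjoint -/

section MapAdjoint

variable {A A' : Type*} [CommRing A] [CommRing A'] {m : ℕ}

/-- `(J⁻¹).map f = (J.map f)⁻¹` for `J` invertible. [cite: Jacobowitz1962, §2] -/
theorem map_nonsing_inv_of_isUnit (f : A →+* A') {J : Matrix (Fin m) (Fin m) A} (hJdet : IsUnit J.det) :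
    J⁻¹.map f = (J.map f)⁻¹ := by
  symm
  apply Matrix.inv_eq_left_inv
  rw [← Matrix.map_mul, Matrix.nonsing_inv_mul J hJdet, Matrix.map_one f (map_zero f) (map_one f)]

/-- **The adjoint commutes with an involution-preserving change of rings** `f` (`f σ = σ′ f`): `(J⁻¹ ᵗ(σX) J).map f = (J ⊗ 1)⁻¹ ᵗ(σ′(X ⊗ 1)) (J ⊗ 1)`
— the adjoint over `L` read in `M_N(𝔸_L)` or `M_N(∏_{w∣v} L_w)`. [cite: Jacobowitz1962, §2] -/
theorem map_hermAdjoint (σ : A →+* A) (σ' : A' →+* A') (f : A →+* A') (hf : ∀ a, f (σ a) = σ' (f a))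
    {J : Matrix (Fin m) (Fin m) A} (hJdet : IsUnit J.det) (X : Matrix (Fin m) (Fin m) A) :
    (J⁻¹ * (X.map σ)ᵀ * J).map f = (J.map f)⁻¹ * ((X.map f).map σ')ᵀ * J.map f := by
  have hcomp : (⇑f ∘ ⇑σ : A → A') = ⇑σ' ∘ ⇑f := funext fun a => hf a
  rw [Matrix.map_mul, Matrix.map_mul, ← Matrix.transpose_map, Matrix.map_map, Matrix.map_map, hcomp, Matrix.transpose_map,
    map_nonsing_inv_of_isUnit f hJdet]

end MapAdjoint

/-! ## §2 The Cartan algebra `L[γ] = Z(γ)` of a regular semisimple matrix: commutant, reduced, stable under the adjoint -/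

section Cartan

variable {L : Type*} [Field L] {N : ℕ} (γ : Matrix (Fin N) (Fin N) L)

/-- For `γ` regular semisimple (separable characteristic polynomial) every matrix commuting with `γ` lies in `L[γ]`
(`Z(γ) = L[γ]`, Horn–Johnson 3.2.4.2). [cite: HornJohnson2013, Thm 3.2.4.2, p0236] -/
theorem mem_adjoin_singleton_of_commute (hreg : γ.charpoly.Separable) {X : Matrix (Fin N) (Fin N) L} (hX : Commute γ X) :
    X ∈ Algebra.adjoin L ({γ} : Set (Matrix (Fin N) (Fin N) L)) := by
  obtain ⟨p, -, rfl⟩ := exists_eq_aeval_of_commute_of_minpoly_eq_charpoly γ X (minpoly_eq_charpoly_of_charpoly_separable γ hreg) hX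
  rw [Algebra.adjoin_singleton_eq_range_aeval]
  exact ⟨p, rfl⟩

omit [Field L] in
/-- Elements of `R[γ]` commute with `γ` (any commutative ring `R`). [cite: HornJohnson2013, Thm 3.2.4.2, p0236] -/
theorem commute_of_mem_adjoin_singleton {L : Type*} [CommRing L] {γ X : Matrix (Fin N) (Fin N) L}
    (hX : X ∈ Algebra.adjoin L ({γ} : Set (Matrix (Fin N) (Fin N) L))) : Commute X γ := by
  have hle : Algebra.adjoin L ({γ} : Set (Matrix (Fin N) (Fin N) L)) ≤ Subalgebra.centralizer L {γ} :=
    Algebra.adjoin_le (Set.singleton_subset_iff.2 (Subalgebra.mem_centralizer_iff L |>.2 fun g hg => by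
      rw [Set.mem_singleton_iff.1 hg]))
  exact ((Subalgebra.mem_centralizer_iff L).1 (hle hX) γ rfl).symm

/-- **`L[γ]` is REDUCED** for `γ` regular semisimple: a nilpotent `p(γ)` has `q_γ ∣ p^k`, and `q_γ = p_γ` is square-free, so `q_γ ∣ p` and
`p(γ) = 0`. [cite: HornJohnson2013, Thm 3.2.4.2, p0236] -/
theorem isReduced_adjoin_singleton (hreg : γ.charpoly.Separable) :
    IsReduced ↥(Algebra.adjoin L ({γ} : Set (Matrix (Fin N) (Fin N) L))) := by
  refine ⟨fun b ⟨k, hk⟩ => ?_⟩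
  have hmin := minpoly_eq_charpoly_of_charpoly_separable γ hreg
  obtain ⟨p, -, hp⟩ := exists_eq_aeval_of_commute_of_minpoly_eq_charpoly γ (b : Matrix (Fin N) (Fin N) L) hmin
    (commute_of_mem_adjoin_singleton b.2).symm
  have hk' : aeval γ (p ^ k) = 0 := by
    rw [map_pow, ← hp, ← Subalgebra.coe_pow, hk, Subalgebra.coe_zero]
  have hdvd : minpoly L γ ∣ p := by
    rcases Nat.eq_zero_or_pos k with rfl | hk0
    · -- `k = 0`: `b ^ 0 = 1 = 0` forces the trivial ring
      rw [pow_zero] at hk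
      have : (b : Matrix (Fin N) (Fin N) L) = 0 := by
        rw [← one_mul b, hk, zero_mul, Subalgebra.coe_zero]
      rw [hp] at this
      exact minpoly.dvd L γ this
    · exact ((hmin ▸ hreg).squarefree.dvd_pow_iff_dvd hk0.ne').1 (minpoly.dvd L γ hk')
  apply Subtype.ext
  rw [hp, Subalgebra.coe_zero]
  obtain ⟨q, rfl⟩ := hdvd
  rw [map_mul, minpoly.aeval, zero_mul]

/-- For `γ` `H`-UNITARY (`ᵗ(σγ) H γ = H`, `H` invertible) and regular semisimple, `L[γ]` is stable under the adjoint `X ↦ H⁻¹ ᵗ(σX) H`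
(★ `commute_hermAdjoint_of_commute`). [cite: Rogawski1990, §3.5 p. 29] -/
theorem hermAdjoint_mem_adjoin_singleton (hreg : γ.charpoly.Separable) (σ : L →+* L) {H : Matrix (Fin N) (Fin N) L}
    (hHdet : IsUnit H.det) (hγ : (γ.map σ)ᵀ * H * γ = H) {X : Matrix (Fin N) (Fin N) L}
    (hX : X ∈ Algebra.adjoin L ({γ} : Set (Matrix (Fin N) (Fin N) L))) :
    H⁻¹ * (X.map σ)ᵀ * H ∈ Algebra.adjoin L ({γ} : Set (Matrix (Fin N) (Fin N) L)) :=
  mem_adjoin_singleton_of_commute γ hreg (commute_hermAdjoint_of_commute σ hHdet hγ (commute_of_mem_adjoin_singleton hX).symm)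

end Cartan

end Literature.LinearAlgebra.Matrix
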